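import Literature.AnabelianGeometry.EtaleTheta.Discharge.Sec1DtpYEllZHat
import HarnessLib

/-!
# [EtTh] §1 pp. 12–13: the CLOSURE of `(Δ^tp_Y)^ell` in `Δ^ell_X` is `Ẑ`, under the freeness guard ALONE
# (proof-only sequel of `Sec1DtpYEllZHat.lean`: the `hYcl`-free profinite core)

Mochizuki, *The étale theta function and its Frobenioid-theoretic manifestations*, Publ. RIMS **45** (2009)
[EtTh], §1, PRIMS PDF pp. 12–13 (printed 238–239): "`1 → Δ_Θ → (Δ^tp_Y)^Θ → (Δ^tp_Y)^ell → 1`",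
"`(Δ^tp_Y)^ell ≅ Ẑ(1)`" [cite: MochizukiEtTh2009, §1 p.13].  Layer L2 of the abc-iut cell, seat abc-iut-w5-d006
(gen 3); PROOF-ONLY, nothing of another seat edited or restated.

The parent file proves `(Δ^tp_Y)^ell ≃* Ẑ` for the TEMPERED object under `IsEtThOrigin` plus the closedness
binder `hYcl` of GAP-LEDGER G-w4d021-2 (exactly as abc-iut-L2-d1's `Δ_Θ ≃* Ẑ`).  This file is the `hYcl`-FREE
profinite core — the twin, for `(Δ^tp_Y)^ell`, of abc-iut-w5-d171's `[Δ_X,Δ_X]⁻/[[Δ_X,Δ_X],Δ_X]⁻ ≃* Ẑ` for `Δ_Θ`.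
With `N := (ι Δ^tp_Y)⁻ ≤ Δ_X` the closure of the image of `Δ^tp_Y` in the profinite completion `Π_X`,
`K₂ = [Δ_X,Δ_X]⁻ ≤ N`, `K₃ = [[Δ_X,Δ_X],Δ_X]⁻`, under `hO : D.IsEtThOrigin` ONLY:
* `ThetaSetting.IsEtThOrigin.mem_commutatorClosure_of_mem_closure_of_commutator_mem` — non-degeneracy of the
  [IUTchII] Rmk. 1.1.1 (iii) commutator pairing on the closure: for `σ ∈ Δ^tp_X` with `toZ σ = 1` and `n ∈ N`,
  `[ι σ, n] ∈ K₃ ⇒ n ∈ K₂` (generalises the parent's `toHat_mem_commutatorClosure_of_commutator_mem` from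
  `ι y` to the closure; same proof — `n` is central in `Δ_X` mod `K₃` since `[ι Δ^tp_Y, N] ≤ K₃`
  (abc-iut-L2-t8's `dtpYTheta_comm`), finite Heisenberg quotients, `DtpYEllAux.mem_of_forall_pairCharacter`);
* `ThetaSetting.IsEtThOrigin.exists_hom_closureDtpY_zHat` — a SURJECTIVE homomorphism `N → Ẑ` with kernel
  exactly `N ∩ K₂` (the pairing `n ↦ [ι σ, n]·K₃` composed with `K₂/K₃ ≃* Ẑ`; surjectivity is abc-iut-L5-t14's
  generic Heisenberg surjectivity `ClassTwo.exists_commutator_mul_of_mem_closure` with `T = ι Δ^tp_X ⊆ (ι σ)^ℤ·N`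
  dense in `Δ_X`);
* `ThetaSetting.IsEtThOrigin.nonempty_closureDtpY_quotient_mulEquiv_zHat` — `N/(N ∩ K₂) ≃* Ẑ`: the closure of
  `(Δ^tp_Y)^ell` in `Δ^ell_X = Δ_X/K₂` IS `Ẑ` with NO closedness binder (the group-structure shadow of L3's
  reading `SemiGraphs.DeltaYEllClosureIsoTate`); so `hYcl`'s only role in the parent file is to identify the
  tempered `(Δ^tp_Y)^ell` with this closure.
(The finite-index / double-underline transfer `(Δ^tp_{Y̲̲})^ell ≃* Ẑ` for the [IUTchII] §1 reading is
abc-iut-w5-d024's sequel `Sec1DeltaYuuEllZHat.lean`, not duplicated here.)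

HONEST FRAMING: group structure only (no Tate twist); [EtTh] is refereed; the theta setting is data quoting
print and is not asserted to exist; nothing here bears on [IUTchIII] Cor. 3.12; typed ≠ proved elsewhere.
-/

noncomputable section

namespace Literature.AnabelianGeometry.EtaleTheta

open Literature.AnabelianGeometry.SemiGraphs Literature.Algebra.Homology Literature.Topology.FourManifolds
open _root_.Topology
open scoped commutatorElement
open CategoryTheory ClassTwo groupCohomology ProfiniteGrp ProfiniteGrp.ProfiniteCompletion

namespace ThetaSetting

open DtpYEllAux

variable {p : ℕ} [Fact p.Prime] (D : ThetaSetting p)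

/-- **Non-degeneracy of the commutator pairing on the closure `N = (ι Δ^tp_Y)⁻`** ([EtTh] pp. 12–13;
[IUTchII] Rmk. 1.1.1 (iii)): under the freeness guard ALONE, for `σ ∈ Δ^tp_X` mapping to the generator `1`
of `Z` and `n` in the closure of `ι Δ^tp_Y` in `Π_X`, if `[ι σ, n] ∈ [[Δ_X,Δ_X],Δ_X]⁻` then `n ∈ [Δ_X,Δ_X]⁻`.
(Generalises `toHat_mem_commutatorClosure_of_commutator_mem` of the parent file from `ι y` to the closure;
same proof.) [cite: MochizukiEtTh2009, §1 p.13] -/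
theorem IsEtThOrigin.mem_commutatorClosure_of_mem_closure_of_commutator_mem (hO : D.IsEtThOrigin)
    {σ : D.PiTemp} (hσ : σ ∈ D.DeltaTemp) (hσZ : D.toZ σ = Multiplicative.ofAdd 1)
    {n : D.PiHat} (hn : n ∈ (D.DtpY.map D.toHat.toMonoidHom).topologicalClosure)
    (h : ⁅D.toHat.toMonoidHom σ, n⁆ ∈ (⁅⁅D.DeltaHat, D.DeltaHat⁆, D.DeltaHat⁆).topologicalClosure) :
    n ∈ (⁅D.DeltaHat, D.DeltaHat⁆).topologicalClosure := by
  classical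
  haveI : CompactSpace D.PiHat := D.isProfiniteCompletion_toHat.compactSpace
  haveI : T2Space D.PiHat := D.isProfiniteCompletion_toHat.t2Space
  haveI hΔn : D.DeltaHat.Normal := SettingCompletion.deltaHat_normal D.toTemperedCurve
  set K₂ : Subgroup D.PiHat := (⁅D.DeltaHat, D.DeltaHat⁆).topologicalClosure with hK₂def
  set K₃ : Subgroup D.PiHat := (⁅⁅D.DeltaHat, D.DeltaHat⁆, D.DeltaHat⁆).topologicalClosure with hK₃def
  have hK₂closed : IsClosed (K₂ : Set D.PiHat) := Subgroup.isClosed_topologicalClosure _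
  have hΔclosed : IsClosed (D.DeltaHat : Set D.PiHat) := Subgroup.isClosed_topologicalClosure _
  -- membership of `ι`-images in `Δ_X`
  have hιΔ : ∀ {t : D.PiTemp}, t ∈ D.DeltaTemp → D.toHat.toMonoidHom t ∈ D.DeltaHat := by
    intro t ht
    have : t ∈ D.DeltaHat.comap D.toHat.toMonoidHom := by
      rw [SettingCompletion.comap_deltaHat D.toTemperedCurve]; exact ht
    exact this
  have hK₃closed : IsClosed (K₃ : Set D.PiHat) := Subgroup.isClosed_topologicalClosure _
  -- `N = (ι Δ^tp_Y)⁻ ≤ Δ_X`, and `[ι Δ^tp_Y, N] ≤ K₃` (`(Δ^tp_Y)^Θ` is abelian: abc-iut-L2-t8)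
  have hNΔ : (D.DtpY.map D.toHat.toMonoidHom).topologicalClosure ≤ D.DeltaHat :=
    Subgroup.topologicalClosure_minimal _
      ((Subgroup.map_mono (inf_le_right : D.DtpY ≤ D.DeltaTemp)).trans (Subgroup.le_topologicalClosure _))
      hΔclosed
  have hYN : ⁅D.DtpY.map D.toHat.toMonoidHom, (D.DtpY.map D.toHat.toMonoidHom).topologicalClosure⁆ ≤ K₃ :=
    (commutator_topologicalClosure_right_le _ _).trans
      (Subgroup.topologicalClosure_minimal _ (D.commutator_map_dtpY_le (D.dtpYTheta_comm hO)) hK₃closed)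
  -- the free pair, topologically generating `Δ_X`
  obtain ⟨hcpt, ht2, htd, -⟩ := hO.deltaHat_free
  haveI : CompactSpace D.DeltaHat := hcpt
  haveI : T2Space D.DeltaHat := ht2
  haveI : TotallyDisconnectedSpace D.DeltaHat := htd
  obtain ⟨a, b, huniv, -⟩ := hO.exists_topologicalGenerators
  -- the element `g = n ∈ Δ_X` and `τ = ι σ ∈ Δ_X`
  set g : D.DeltaHat := ⟨n, hNΔ hn⟩ with hgdef
  set τ : D.DeltaHat := ⟨D.toHat.toMonoidHom σ, hιΔ hσ⟩ with hτdef
  -- `K₂ ∩ Δ_X` as a closed normal subgroup of `Δ_X` containing the commutators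
  haveI hK₂n : K₂.Normal := Subgroup.is_normal_topologicalClosure _
  haveI : (K₂.subgroupOf D.DeltaHat).Normal := inferInstance
  have hKc : IsClosed ((K₂.subgroupOf D.DeltaHat : Subgroup D.DeltaHat) : Set D.DeltaHat) :=
    hK₂closed.preimage continuous_subtype_val
  have hKcomm : ⁅(⊤ : Subgroup D.DeltaHat), (⊤ : Subgroup D.DeltaHat)⁆ ≤ K₂.subgroupOf D.DeltaHat := by
    refine Subgroup.commutator_le.mpr fun u _ v _ => ?_
    rw [Subgroup.mem_subgroupOf]
    have hc : ((⁅u, v⁆ : D.DeltaHat) : D.PiHat) = ⁅(u : D.PiHat), (v : D.PiHat)⁆ := by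
      simp only [commutatorElement_def, Subgroup.coe_mul, Subgroup.coe_inv]
    rw [hc]
    exact Subgroup.le_topologicalClosure _ (Subgroup.commutator_mem_commutator u.2 v.2)
  -- it suffices to kill `g` under every pair-character `Δ_X → (ℤ/n)²`
  suffices hmem : g ∈ K₂.subgroupOf D.DeltaHat by
    rw [Subgroup.mem_subgroupOf] at hmem
    exact hmem
  refine mem_of_forall_pairCharacter hKc hKcomm huniv fun n _ F hFa hFb => ?_
  -- the Heisenberg test group of level `n` and `F^H : Δ_X → H`, `a ↦ x`, `b ↦ y`
  obtain ⟨H, hHgrp, hHfin, x₀, y₀, pr, hprx, hpry, hQ3, hcenter⟩ := exists_classTwo_center_test n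
  letI : Group H := hHgrp
  haveI : Finite H := hHfin
  letI : TopologicalSpace H := ⊥
  haveI : DiscreteTopology H := ⟨rfl⟩
  obtain ⟨FH, ⟨hFHa, hFHb⟩, -⟩ := huniv H x₀ y₀
  have hFHc : Continuous FH.toMonoidHom := FH.continuous_toFun
  -- `pr ∘ F^H = F` (uniqueness of the freeness against `(ℤ/n)²`)
  have hprF : ∀ t : D.DeltaHat, pr (FH t) = F t := by
    obtain ⟨F₀, -, huniq⟩ := huniv (Multiplicative (ZMod n × ZMod n))
      (Multiplicative.ofAdd ((1 : ZMod n), (0 : ZMod n))) (Multiplicative.ofAdd ((0 : ZMod n), (1 : ZMod n)))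
    have hprc : Continuous pr := continuous_of_discreteTopology
    let P : D.DeltaHat →ₜ* Multiplicative (ZMod n × ZMod n) :=
      { toMonoidHom := pr.comp FH.toMonoidHom
        continuous_toFun := hprc.comp FH.continuous_toFun }
    have hP : P = F₀ := by
      refine huniq P ⟨?_, ?_⟩
      · change pr (FH a) = _
        rw [hFHa, hprx]
      · change pr (FH b) = _
        rw [hFHb, hpry]
    have hF : F = F₀ := huniq F ⟨hFa, hFb⟩
    intro t
    change P t = F t
    rw [hP, hF]
  -- `F^H` kills `K₂`'s commutators with `Δ_X`, i.e. `K₃`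
  have hF2 : ∀ t : D.DeltaHat, (t : D.PiHat) ∈ K₂ →
      FH.toMonoidHom t ∈ (⁅(⊤ : Subgroup H), (⊤ : Subgroup H)⁆ : Subgroup H) := by
    have h2 : K₂ ≤ ((⁅(⊤ : Subgroup H), (⊤ : Subgroup H)⁆ : Subgroup H).comap FH.toMonoidHom).map
        D.DeltaHat.subtype := by
      refine Subgroup.topologicalClosure_minimal _ (Subgroup.commutator_le.mpr ?_)
        (isClosed_map_subtype_comap hΔclosed FH.toMonoidHom hFHc _)
      intro g₁ hg₁ g₂ hg₂
      refine ⟨⁅(⟨g₁, hg₁⟩ : D.DeltaHat), ⟨g₂, hg₂⟩⁆, ?_, rfl⟩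
      rw [SetLike.mem_coe, Subgroup.mem_comap, map_commutatorElement]
      exact Subgroup.commutator_mem_commutator (Subgroup.mem_top (FH.toMonoidHom ⟨g₁, hg₁⟩))
        (Subgroup.mem_top (FH.toMonoidHom ⟨g₂, hg₂⟩))
    exact fun t ht => mem_of_coe_mem_map_subtype_comap FH.toMonoidHom _ (h2 ht)
  have hF3 : ∀ t : D.DeltaHat, (t : D.PiHat) ∈ K₃ → FH.toMonoidHom t = 1 := by
    have h3 : K₃ ≤ ((⁅⁅(⊤ : Subgroup H), (⊤ : Subgroup H)⁆, (⊤ : Subgroup H)⁆ : Subgroup H).comap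
        FH.toMonoidHom).map D.DeltaHat.subtype := by
      refine Subgroup.topologicalClosure_minimal _ (Subgroup.commutator_le.mpr ?_)
        (isClosed_map_subtype_comap hΔclosed FH.toMonoidHom hFHc _)
      intro c₀ hc₀ g' hg'
      have hc₀' : c₀ ∈ D.DeltaHat :=
        D.commutatorClosure_le_deltaHat (Subgroup.le_topologicalClosure _ hc₀)
      refine ⟨⁅(⟨c₀, hc₀'⟩ : D.DeltaHat), ⟨g', hg'⟩⁆, ?_, rfl⟩
      rw [SetLike.mem_coe, Subgroup.mem_comap, map_commutatorElement]
      exact Subgroup.commutator_mem_commutator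
        (hF2 ⟨c₀, hc₀'⟩ (Subgroup.le_topologicalClosure _ hc₀)) (Subgroup.mem_top (FH.toMonoidHom ⟨g', hg'⟩))
    intro t ht
    exact hQ3 _ (mem_of_coe_mem_map_subtype_comap FH.toMonoidHom _ (h3 ht))
  -- the elements of `Δ_X` whose `F^H`-image commutes with `F^H g` form a closed subgroup `C` of `Π_X` …
  let C : Subgroup D.PiHat :=
    ((Subgroup.centralizer ({FH.toMonoidHom g} : Set H)).comap FH.toMonoidHom).map D.DeltaHat.subtype
  have hCclosed : IsClosed (C : Set D.PiHat) :=
    isClosed_map_subtype_comap hΔclosed FH.toMonoidHom hFHc _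
  have hC_of : ∀ t : D.DeltaHat, FH.toMonoidHom (t * g * t⁻¹ * g⁻¹) = 1 → (t : D.PiHat) ∈ C := by
    intro t ht
    refine ⟨t, ?_, rfl⟩
    rw [SetLike.mem_coe, Subgroup.mem_comap, Subgroup.mem_centralizer_iff]
    intro h' hh'
    rw [Set.mem_singleton_iff] at hh'
    subst hh'
    rw [map_mul, map_mul, map_mul, map_inv, map_inv, ← commutatorElement_def,
      commutatorElement_eq_one_iff_mul_comm] at ht
    exact ht.symm
  -- … containing `τ = ι σ` (the hypothesis `[ι σ, ι y] ∈ K₃`) …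
  have hτC : (τ : D.PiHat) ∈ C := by
    refine hC_of τ (hF3 _ ?_)
    simp only [Subgroup.coe_mul, Subgroup.coe_inv, hτdef, hgdef]
    rw [← commutatorElement_def]
    exact h
  -- … and `ι Δ^tp_Y` (`(Δ^tp_Y)^Θ` is abelian: abc-iut-L2-t8) …
  have hYC : ∀ y' ∈ D.DtpY, D.toHat.toMonoidHom y' ∈ C := by
    intro y' hy'
    have hy'Δ : y' ∈ D.DeltaTemp := (inf_le_right : D.DtpY ≤ D.DeltaTemp) hy'
    refine hC_of ⟨D.toHat.toMonoidHom y', hιΔ hy'Δ⟩ (hF3 _ ?_)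
    simp only [Subgroup.coe_mul, Subgroup.coe_inv, hgdef]
    rw [← commutatorElement_def]
    exact hYN (Subgroup.commutator_mem_commutator (Subgroup.mem_map_of_mem _ hy') hn)
  -- … hence `ι Δ^tp_X ⊆ (ι σ)^ℤ · ι Δ^tp_Y` and, `C` being closed, all of `Δ_X`
  have hΔC : D.DeltaHat ≤ C := by
    change (D.DeltaTemp.map D.toHat.toMonoidHom).topologicalClosure ≤ C
    refine Subgroup.topologicalClosure_minimal _ ?_ hCclosed
    rintro _ ⟨t, ht, rfl⟩
    obtain ⟨i, u, hu, rfl⟩ := D.exists_eq_zpow_mul_of_mem_deltaTemp hσ hσZ ht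
    rw [map_mul, map_zpow]
    exact C.mul_mem (C.zpow_mem hτC i) (hYC u hu)
  have hcomm_of_C : ∀ t : D.DeltaHat, (t : D.PiHat) ∈ C → Commute (FH.toMonoidHom g) (FH.toMonoidHom t) := by
    intro t ht
    have hmem := mem_of_coe_mem_map_subtype_comap FH.toMonoidHom _ ht
    rw [Subgroup.mem_centralizer_iff] at hmem
    exact (hmem _ (Set.mem_singleton _))
  have hx : Commute (FH g) x₀ := by
    rw [← hFHa]
    exact hcomm_of_C a (hΔC a.2)
  have hy₀ : Commute (FH g) y₀ := by
    rw [← hFHb]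
    exact hcomm_of_C b (hΔC b.2)
  rw [← hprF g]
  exact hcenter (FH g) hx hy₀

/-- **The closure of `(Δ^tp_Y)^ell` in `Δ^ell_X` is `Ẑ`, homomorphism form** ([EtTh] p. 13
"`(Δ^tp_Y)^ell ≅ Ẑ(1)`"), under the freeness guard ALONE: with `N = (ι Δ^tp_Y)⁻`, there is a SURJECTIVE
homomorphism `N → Ẑ` whose kernel is exactly `N ∩ [Δ_X,Δ_X]⁻` — the commutator pairing with `ι σ` read in
`[Δ_X,Δ_X]⁻/[[Δ_X,Δ_X],Δ_X]⁻ ≅ Ẑ`. [cite: MochizukiEtTh2009, §1 p.13] -/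
theorem IsEtThOrigin.exists_hom_closureDtpY_zHat (hO : D.IsEtThOrigin) :
    ∃ Λ : ↥(D.DtpY.map D.toHat.toMonoidHom).topologicalClosure →* ZHat, Function.Surjective Λ ∧
      ∀ n : ↥(D.DtpY.map D.toHat.toMonoidHom).topologicalClosure,
        Λ n = 1 ↔ (n : D.PiHat) ∈ (⁅D.DeltaHat, D.DeltaHat⁆).topologicalClosure := by
  classical
  haveI : CompactSpace D.PiHat := D.isProfiniteCompletion_toHat.compactSpace
  haveI : T2Space D.PiHat := D.isProfiniteCompletion_toHat.t2Space
  haveI hΔn : D.DeltaHat.Normal := SettingCompletion.deltaHat_normal D.toTemperedCurve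
  haveI hK₃n : (⁅⁅D.DeltaHat, D.DeltaHat⁆, D.DeltaHat⁆).topologicalClosure.Normal :=
    Subgroup.is_normal_topologicalClosure _
  set K₂ : Subgroup D.PiHat := (⁅D.DeltaHat, D.DeltaHat⁆).topologicalClosure with hK₂def
  set K₃ : Subgroup D.PiHat := (⁅⁅D.DeltaHat, D.DeltaHat⁆, D.DeltaHat⁆).topologicalClosure with hK₃def
  set N : Subgroup D.PiHat := (D.DtpY.map D.toHat.toMonoidHom).topologicalClosure with hNdef
  -- class-two data `A = Δ_X ⊇ K₂ ⊇ K₃`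
  have hΔclosed : IsClosed (D.DeltaHat : Set D.PiHat) := Subgroup.isClosed_topologicalClosure _
  have hK₃closed : IsClosed (K₃ : Set D.PiHat) := Subgroup.isClosed_topologicalClosure _
  have hNclosed : IsClosed (N : Set D.PiHat) := Subgroup.isClosed_topologicalClosure _
  have hAA : ⁅D.DeltaHat, D.DeltaHat⁆ ≤ K₂ := Subgroup.le_topologicalClosure _
  have hK₂A : K₂ ≤ D.DeltaHat := D.commutatorClosure_le_deltaHat
  have hAK : ⁅D.DeltaHat, K₂⁆ ≤ K₃ := by
    refine (commutator_topologicalClosure_right_le _ _).trans (le_of_eq ?_)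
    rw [Subgroup.commutator_comm D.DeltaHat ⁅D.DeltaHat, D.DeltaHat⁆]
  have hιΔ : ∀ {t : D.PiTemp}, t ∈ D.DeltaTemp → D.toHat.toMonoidHom t ∈ D.DeltaHat := by
    intro t ht
    have : t ∈ D.DeltaHat.comap D.toHat.toMonoidHom := by
      rw [SettingCompletion.comap_deltaHat D.toTemperedCurve]; exact ht
    exact this
  -- `N ≤ Δ_X`, closed, abelian modulo `K₃` (abc-iut-L2-t8: `(Δ^tp_Y)^Θ` is commutative)
  have hNΔ : N ≤ D.DeltaHat :=
    Subgroup.topologicalClosure_minimal _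
      ((Subgroup.map_mono (inf_le_right : D.DtpY ≤ D.DeltaTemp)).trans (Subgroup.le_topologicalClosure _))
      hΔclosed
  have hNab : ⁅N, N⁆ ≤ K₃ := by
    have h1 : ⁅N, D.DtpY.map D.toHat.toMonoidHom⁆ ≤ K₃ :=
      (commutator_topologicalClosure_left_le _ _).trans
        (Subgroup.topologicalClosure_minimal _ (D.commutator_map_dtpY_le (D.dtpYTheta_comm hO)) hK₃closed)
    exact (commutator_topologicalClosure_right_le _ _).trans
      (Subgroup.topologicalClosure_minimal _ h1 hK₃closed)
  -- a generator `σ` of `Z = Δ^tp_X/Δ^tp_Y`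
  obtain ⟨⟨σ, hσ⟩, hσZ'⟩ := D.toZ_delta_surjective (Multiplicative.ofAdd 1)
  have hσZ : D.toZ σ = Multiplicative.ofAdd 1 := hσZ'
  -- abc-iut-w5-d171's `φ : K₂ ↠ Ẑ` with kernel `K₃`
  obtain ⟨a, b, φ, -, hφs, hφk, -⟩ := hO.exists_hom_commutatorClosure_zHat
  have hφcongr : ∀ u v : ↥K₂, ((u : D.PiHat) : D.PiHat ⧸ K₃) = (v : D.PiHat) → φ u = φ v := by
    intro u v huv
    rw [QuotientGroup.eq] at huv
    have h1 : φ (u⁻¹ * v) = 1 := (hφk (u⁻¹ * v)).mpr (by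
      rw [Subgroup.coe_mul, Subgroup.coe_inv]; exact huv)
    rwa [map_mul, map_inv, inv_mul_eq_one] at h1
  -- the pairing `n ↦ [ι σ, n] ∈ K₂`
  have hcmem : ∀ n : ↥N, ⁅D.toHat.toMonoidHom σ, (n : D.PiHat)⁆ ∈ K₂ := fun n =>
    hAA (Subgroup.commutator_mem_commutator (hιΔ hσ) (hNΔ n.2))
  let c : ↥N → ↥K₂ := fun n => ⟨⁅D.toHat.toMonoidHom σ, (n : D.PiHat)⁆, hcmem n⟩
  have hc : ∀ n : ↥N, (c n : D.PiHat) = ⁅D.toHat.toMonoidHom σ, (n : D.PiHat)⁆ := fun n => rfl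
  let Λ : ↥N →* ZHat :=
    { toFun := fun n => φ (c n)
      map_one' := by
        have h1 : c 1 = 1 := Subtype.ext (by
          rw [hc, OneMemClass.coe_one, commutatorElement_one_right, OneMemClass.coe_one])
        rw [h1, map_one]
      map_mul' := fun n n' => by
        rw [← map_mul]
        refine hφcongr _ _ ?_
        rw [hc, Subgroup.coe_mul, Subgroup.coe_mul, hc, hc, QuotientGroup.mk_mul]
        exact mk_commutator_mul_right D.DeltaHat K₂ K₃ hAA hAK (hιΔ hσ) (hNΔ n.2) (hNΔ n'.2) }
  have hΛ : ∀ n, Λ n = φ (c n) := fun n => rfl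
  refine ⟨Λ, ?_, fun n => ?_⟩
  · -- surjectivity: generic Heisenberg surjectivity (abc-iut-L5-t14) with `T = ι Δ^tp_X ⊆ (ι σ)^ℤ · N` dense
    intro t
    obtain ⟨k, rfl⟩ := hφs t
    have hAT : (D.DeltaHat : Set D.PiHat) ⊆
        closure ((D.DeltaTemp.map D.toHat.toMonoidHom : Subgroup D.PiHat) : Set D.PiHat) := by
      change (((D.DeltaTemp.map D.toHat.toMonoidHom).topologicalClosure : Subgroup D.PiHat) : Set D.PiHat) ⊆ _
      rw [Subgroup.topologicalClosure_coe]
    have hT : ∀ t ∈ D.DeltaTemp.map D.toHat.toMonoidHom, ∃ i : ℤ, ∃ n ∈ N,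
        t = D.toHat.toMonoidHom σ ^ i * n := by
      rintro _ ⟨t, ht, rfl⟩
      obtain ⟨i, u, hu, rfl⟩ := D.exists_eq_zpow_mul_of_mem_deltaTemp hσ hσZ ht
      exact ⟨i, D.toHat.toMonoidHom u, Subgroup.le_topologicalClosure _ (Subgroup.mem_map_of_mem _ hu),
        by rw [map_mul, map_zpow]⟩
    obtain ⟨n, hn, k₃, hk₃, hkeq⟩ := exists_commutator_mul_of_mem_closure D.DeltaHat K₂ K₃ hAA hK₂A hAK
      hK₃closed (hιΔ hσ) N hNΔ hNclosed hNab (D.DeltaTemp.map D.toHat.toMonoidHom) hAT hT k k.2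
    refine ⟨⟨n, hn⟩, ?_⟩
    rw [hΛ]
    refine hφcongr _ _ ?_
    rw [hc, hkeq, QuotientGroup.mk_mul, (QuotientGroup.eq_one_iff k₃).mpr hk₃, mul_one]
  · -- kernel: `[ι σ, n] ∈ K₃ ↔ n ∈ K₂`
    rw [hΛ, hφk, hc]
    constructor
    · exact hO.mem_commutatorClosure_of_mem_closure_of_commutator_mem D hσ hσZ n.2
    · intro hnK
      exact hAK (Subgroup.commutator_mem_commutator (hιΔ hσ) hnK)

/-- **The closure of `(Δ^tp_Y)^ell` in `Δ^ell_X` IS `Ẑ`** ([EtTh] p. 13 "`(Δ^tp_Y)^ell ≅ Ẑ(1)`"; the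
group-structure shadow of the L3 reading `SemiGraphs.DeltaYEllClosureIsoTate`): under the freeness guard ALONE,
`N/(N ∩ [Δ_X,Δ_X]⁻) ≃* Ẑ` for `N = (ι Δ^tp_Y)⁻` — no closedness binder.  (The quotient GROUP structure needs
the normality of `[Δ_X,Δ_X]⁻` as an INSTANCE, taken as an instance-implicit binder as in abc-iut-w5-d171's
`exists_zHat_param_commutatorClosure`; discharge it with `Subgroup.is_normal_topologicalClosure _` after
`haveI := SettingCompletion.deltaHat_normal D.toTemperedCurve`.) [cite: MochizukiEtTh2009, §1 p.13] -/
theorem IsEtThOrigin.nonempty_closureDtpY_quotient_mulEquiv_zHat (hO : D.IsEtThOrigin)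
    [((⁅D.DeltaHat, D.DeltaHat⁆).topologicalClosure).Normal] :
    Nonempty (↥(D.DtpY.map D.toHat.toMonoidHom).topologicalClosure ⧸
      ((⁅D.DeltaHat, D.DeltaHat⁆).topologicalClosure.subgroupOf
        (D.DtpY.map D.toHat.toMonoidHom).topologicalClosure) ≃* ZHat) := by
  obtain ⟨Λ, hΛs, hΛk⟩ := hO.exists_hom_closureDtpY_zHat D
  have hkerEq : Λ.ker = (⁅D.DeltaHat, D.DeltaHat⁆).topologicalClosure.subgroupOf
      (D.DtpY.map D.toHat.toMonoidHom).topologicalClosure := by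
    ext n
    rw [MonoidHom.mem_ker, hΛk n, Subgroup.mem_subgroupOf]
  exact ⟨(QuotientGroup.quotientMulEquivOfEq hkerEq).symm.trans
    (QuotientGroup.quotientKerEquivOfSurjective Λ hΛs)⟩

end ThetaSetting

end Literature.AnabelianGeometry.EtaleTheta

end
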